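import Summits.FinalStateConjecture.FinalStateConjecture.Theorems.BartnikGapSettlingBondiBartnikRigidityOuterBoundaryCollarChartDefs
import Summits.FinalStateConjecture.FinalStateConjecture.Theorems.BartnikGapSettlingBondiBartnikRigidityRouteMarchingDefs
import Summits.FinalStateConjecture.FinalStateConjecture.Theorems.BartnikGapSettlingBondiBartnikRigiditySlabCauchyRigidityFactorisation
import HarnessLib

/-!
# The typed route to the corrected K2a `K2Route.OuterBoundaryCollarChartOriented'` — line
# `direct-method-on-the-cone` (crux `BondiBartnikRigidity`, stmt-FinalStateConjecture-10807), wave-2 worker K2a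
# of lead c3

Typed statements (route-posited, `[conjecture]`; nothing asserted) of the inputs of the corrected K2a'
(`…OuterBoundaryCollarChartDefs.lean`; the registered stub `stub_outerBoundaryCollarChart'` of skeleton rev 6)
and the CHECKED reduction `outerBoundaryCollarChartOriented'_of_facts : F3' → F4a' → F4b' → RoofReach → K2a'`
(closed form = the registered sub-goal `stub_outerBoundaryCollarChart'_of_facts`):

* F2' `MullerZumHagenSpacetime` — PORT to `Spacetime 4` of the tree's named fact
  `mullerZumHagen1970_analytic_of_timelikeKilling` (analytic charts near points where a Killing field is timelike);
  the analytic input of F3', not entering the plumbing;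
* F3' `TimelikeKillingKerrContinuation'` — local exact `ξ`-charts on the `ξ`-timelike component of an exact seed
  (analytic developing map, Kobayashi–Nomizu VI.6.1; image radius controlled by the Weyl invariant
  `(r − ia cos θ)⁶ = 3M²/I`);
* F4a' `OuterRoofStationarity'` — the outer roof stays in the `ξ`-timelike component (continuity of
  `ζ = (3M²/|I|)^{1/6}`: `≥ 3M` on the roof, `≤ 2M` on any ergosurface);
* F4b' `RoofCollarCoherence` — local charts ⟹ one maximal boundary-collar chart, `S₃ ⊆ O`, injectivity via `ζ`;
* `RoofReach` — maximal chart + `HasCutBondiMass` ⟹ the roof portion `roofK ∩ {r ≤ ρ}` for every `ρ` (pinned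
  sections of the cone have divergent Hawking masses, `m_H = M√(⨍f²)⨍(1/f)` on the Schwarzschild cone).

Audit and paper arguments: report `Cruxes/BondiBartnikRigidity/Lines/direct-method-on-the-cone-K2a-c3.md`.
References: Müller zum Hagen 1970 [MullerZumHagen1970]; Carter 1968 §3 [Carter1968]; Kobayashi–Nomizu 1963,
VI Thm 6.1 [KobayashiNomizu1963]; O'Neill 1983, Prop. 3.62 [ONeill1983]; Hawking–Ellis 1973, §6.3, §9.3
[HawkingEllis1973CUP]; Christodoulou–Klainerman 1993, Ch. 17 [ChristodoulouKlainerman1993PMS41].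
-/

noncomputable section

-- D-0017: single-problem summit, `Summit.<S>.<S>.…` by design (cf. lakefile `weak.linter.dupNamespace`).
set_option linter.dupNamespace false
-- instance search through the nested operator types of the Kerr chart facts
set_option maxSynthPendingDepth 3

open Set Filter Function Topology TopologicalSpace
open Literature.Geometry.Lorentzian
open scoped Manifold ContDiff Topology ENNReal

namespace Summit.FinalStateConjecture.FinalStateConjecture.Theorems.BondiBartnikRigidity.DirectMethod

/-! ## The typed route to the corrected K2a (`OuterBoundaryCollarChartOriented'`)

K2a' ⟸ F3' `TimelikeKillingKerrContinuation'` ∧ F4a' `OuterRoofStationarity'` ∧ F4b' `RoofCollarCoherence`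
∧ `RoofReach` — the checked reduction `outerBoundaryCollarChartOriented'_of_facts` below is pure plumbing.
F2' `MullerZumHagenSpacetime` (port of the tree's named fact to `Spacetime 4`) is the analytic input of F3'
and does not enter the plumbing. -/

namespace K2Route

open F1Route

/-! ### F2' — Müller zum Hagen analyticity on an arbitrary spacetime (PORT of a tree named fact) -/

/-- **F2' `MullerZumHagenSpacetime`** — a vacuum metric is real-analytic in suitable charts of the
maximal `C^∞` atlas near every point where a Killing field (Killing on an open set) is timelike.
The tree's named fact `mullerZumHagen1970_analytic_of_timelikeKilling`
(`Literature/Geometry/Lorentzian/MullerZumHagenAnalyticity.lean`, decomposed in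
`MullerZumHagenStationaryHarmonicGauge.lean`) is this statement over the carrier of a
`StationaryAFBlackHole`; here over an arbitrary `Spacetime 4` (the theorem is local and the proof
identical).  EXISTS in the tree in the wrong carrier — a PORT, input of F3' only.
(ref: MullerZumHagen1970, Theorem, pp. 199–201) (ref: HawkingEllis1973CUP, §9.3 p. 324)
Route-posited restatement; nothing is asserted. [conjecture] [folklore] -/
def MullerZumHagenSpacetime : Prop :=
  ∀ (𝒮 : Spacetime.{0} 4) [𝒮.metric.toPseudoRiemannianMetric.HasLeviCivita],
    𝒮.metric.toPseudoRiemannianMetric.IsRicciFlat →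
    ∀ (U : Set 𝒮.carrier) (K : Π x : 𝒮.carrier, TangentSpace (𝓡 4) x), IsOpen U →
      𝒮.metric.IsKillingFieldOn K U →
      ∀ y ∈ U, 𝒮.metric.val y (K y) (K y) < 0 →
        ∃ ψ ∈ IsManifold.maximalAtlas (𝓡 4) ((⊤ : ℕ∞) : WithTop ℕ∞) 𝒮.carrier,
          y ∈ ψ.source ∧ ∀ v w : E4,
            AnalyticOnNhd ℝ (fun q : E4 ↦ 𝒮.metric.val (ψ.symm q)
              (mfderiv 𝓘(ℝ, E4) (𝓡 4) ψ.symm q v) (mfderiv 𝓘(ℝ, E4) (𝓡 4) ψ.symm q w)) ψ.target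

/-! ### F3' — Kerr continuation on the `ξ`-timelike component of an exact seed -/

variable {X : Type} [TopologicalSpace X] [ChartedSpace E3 X] [IsManifold (𝓡 3) ∞ X]
  [ConnectedSpace X] {D : InitialDataSet (𝓡 3) X}

/-- **F3' `TimelikeKillingKerrContinuation'`** — let `ξ` be Killing on an open set `U` of a vacuum
Cauchy development and EXACTLY the push-forward `dΨ₀(Λe₀)` of the boosted Kerr-star time translation on
an exact open SEED `Ψ₀(Q₀) ⊆ U` of the star background `(Λ, c, M, a)`, `|a| < M`, containing a point
`x₀` of the strictly stationary shell `r > 2M`.  Then every point of the connected component `V` of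
`{y ∈ U | g(ξ, ξ)(y) < 0}` through `Ψ₀ x₀` is covered by an exact local chart of the same background on
which `ξ = dΨ(Λe₀)`.  Paper proof: `(V, g)` is real-analytic (F2'); a local isometry into the analytic
Kerr chart continues along every path of `V` (developing map, Kobayashi–Nomizu I, Ch. VI, Thm. 6.1): the
image can neither reach the ergosurface (`g(ξ, ξ) ≤ −c < 0` on a compact path) nor `r ∈ {0, ∞}`
(`|r − ia cos θ| = (3M²/|I|)^{1/6}`, `I` the quadratic Weyl invariant, is continuous on the path) and
stays in the OUTER stationary region `{r > r_E⁺(θ)} ⊆ {r > M}` by connectedness; the continued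
correspondence keeps `ξ ↦ ∂_{t*}` (analytic Killing fields agreeing on an open set).  Generalises the
box-seeded F3 of K2-report-a2 §3.  UNPRINTED as a package (classical ingredients); MISSING in the tree.
(ref: MullerZumHagen1970, Theorem) (Kobayashi–Nomizu I, Ch. VI, Thm. 6.1 — no bib key)
Route-posited statement; nothing is asserted. [conjecture] [folklore] -/
def TimelikeKillingKerrContinuation' : Prop :=
  ∀ (X : Type) [TopologicalSpace X] [ChartedSpace E3 X] [IsManifold (𝓡 3) ∞ X]
    [T2Space X] [SecondCountableTopology X] [ConnectedSpace X]
    (D : InitialDataSet (𝓡 3) X) (𝒱 : VacuumCauchyDevelopment D)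
    (M a : ℝ) (mo : lorentzGroup × E4) (B : ModelBackground) (U : Set 𝒱.carrier)
    (ξ : Π x : 𝒱.carrier, TangentSpace (𝓡 4) x) (Q₀ : Set B.domain)
    (Ψ₀ : B.domain → 𝒱.carrier) (x₀ : B.domain),
    0 < M → |a| < M →
    B = starBackground mo.1 mo.2 M a (fun x => Kerr.radius a (poincareInv mo.1 mo.2 x)) →
    IsOpen U →
    ∀ [𝒱.metric.toPseudoRiemannianMetric.HasLeviCivita],
    𝒱.metric.IsKillingFieldOn ξ U →
    IsOpen Q₀ → x₀ ∈ Q₀ → 2 * M < B.radius x₀.1 →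
    ContMDiffOn 𝓘(ℝ, E4) (𝓡 4) ∞ Ψ₀ Q₀ → IsOpenEmbedding (Q₀.restrict Ψ₀) → Ψ₀ '' Q₀ ⊆ U →
    supCkENorm (Subtype.val '' Q₀) 0 (𝒱.toSpacetime.deviationExtend B Ψ₀) ≤ 0 →
    (∀ x ∈ Q₀, ξ (Ψ₀ x) = mfderiv 𝓘(ℝ, E4) (𝓡 4) Ψ₀ x ((mo.1 : E4 ≃L[ℝ] E4) (E4.basisVector 0))) →
    ∀ y ∈ connectedComponentIn {z | z ∈ U ∧ 𝒱.metric.val z (ξ z) (ξ z) < 0} (Ψ₀ x₀),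
      ∃ (Q : Set B.domain) (Ψ : B.domain → 𝒱.carrier), IsOpen Q ∧ y ∈ Ψ '' Q ∧
        ContMDiffOn 𝓘(ℝ, E4) (𝓡 4) ∞ Ψ Q ∧ IsOpenEmbedding (Q.restrict Ψ) ∧ Ψ '' Q ⊆ U ∧
        supCkENorm (Subtype.val '' Q) 0 (𝒱.toSpacetime.deviationExtend B Ψ) ≤ 0 ∧
        ∀ x ∈ Q, ξ (Ψ x) = mfderiv 𝓘(ℝ, E4) (𝓡 4) Ψ x ((mo.1 : E4 ≃L[ℝ] E4) (E4.basisVector 0))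

/-! ### F4a' — the outer roof stays in the timelike component of the diamond (the former open point) -/

/-- **F4a' `OuterRoofStationarity'`** — under the hypotheses of the corrected K2a and for its diamond
chart `Ψ_Δ`: there is an open `O₁ ⊇ outerRoof ∪ Φ₀(S₃)` such that `O₁ ∩ (killingDomain)°` lies in the
`ξ`-timelike component of (any) shell point `Ψ_Δ x₀`, `x₀ ∈ Δ' ∩ {r > 2M}`.  Paper proof (worker K2a,
closing the "one-sided control" gap of K2-report-a2 F4): open–closed along the roof.  OPEN-ness: F3'
charts.  CLOSED-ness = one-sided control at a limit roof point `y`: the modulus of the Weyl invariant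
`ζ := (3M²/|I|)^{1/6}` is CONTINUOUS on `𝒱 ∋ y` (the metric is `C²` at `y`, `I(y) ≠ 0` being the
one-sided Kerr limit) and equals `|r − ia cos θ| ≥ r ≥ 3M − o(1)` on the charted side near `y`, while at
every boundary point `z ∈ ∂V ∩ U` of the timelike component `g(ξ, ξ)(z) = 0` forces the Kerr position of
the approaching charted points onto the ergosurface, where `ζ² = 2M² + 2M√(M² − a²cos²θ) ≤ 4M²`; so
`∂V` stays out of a neighbourhood of `y`, whose (connected, half-ball) trace on `U` therefore lies in
`V`.  Along the roof the local Kerr radius is that of Kerr's roof generators (`ṙ > 0` for the outgoing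
null normals of `S₃`: Carter 1968), `≥ 3M > 2M ≥ r_E`.  UNPRINTED; MISSING in the tree.
(ref: Carter1968, §3) Route-posited statement; nothing is asserted. [conjecture] [folklore] -/
def OuterRoofStationarity' : Prop :=
  ∀ [Kerr.Facts] (k' : ℕ), 2 ≤ k' →
    ∀ (X : Type) [TopologicalSpace X] [ChartedSpace E3 X] [IsManifold (𝓡 3) ∞ X]
      [T2Space X] [SecondCountableTopology X] [ConnectedSpace X]
      (D : InitialDataSet (𝓡 3) X) (𝒱 : VacuumCauchyDevelopment D)
      (M a : Fin 1 → ℝ) (p : 𝒱.carrier) (mo : Fin 1 → lorentzGroup × E4)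
      (B : Fin 1 → ModelBackground) (Φ : ∀ i, (B i).domain → 𝒱.carrier)
      (hmax : 𝒱.IsMaximal) (hpar : ∀ i, 0 < M i ∧ |a i| < M i),
    (∃ i, p ∈ Φ i '' (B i).truncTimeSlab (3 * M i) 0) →
    (∀ i, B i = starBackground (mo i).1 (mo i).2 (M i) (a i)
      (fun x => Kerr.radius (a i) (poincareInv (mo i).1 (mo i).2 x))) →
    (∀ i, ContMDiffOn 𝓘(ℝ, E4) (𝓡 4) ∞ (Φ i)
        {x | -1 < (B i).time x.1 ∧ (B i).time x.1 < 1 ∧ (B i).radius x.1 < 3 * M i + 1} ∧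
      IsOpenEmbedding ({x | -1 < (B i).time x.1 ∧ (B i).time x.1 < 1 ∧
        (B i).radius x.1 < 3 * M i + 1}.restrict (Φ i))) →
    (∀ i, 𝒱.toSpacetime.truncDeviationCk (B i) (Φ i) k' (3 * M i) 0 ≤ 0) →
    CollarFutureOriented 𝒱 M mo B Φ →
    collarCore M p B Φ ⊆ range 𝒱.embed →
    (∃ m : ℝ, 𝒱.toCauchyDevelopment.HasCutBondiMass (collarCore M p B Φ) m) →
    ∀ [𝒱.metric.toPseudoRiemannianMetric.HasLeviCivita],
    ∀ (ξ : Π x : 𝒱.carrier, TangentSpace (𝓡 4) x) (ΨΔ : (B 0).domain → 𝒱.carrier),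
    𝒱.metric.IsKillingFieldOn ξ (interior (killingDomain 𝒱 M p B Φ)) →
    (∀ x ∈ (B 0).truncTimeSlab (3 * M 0) 0, ΨΔ x = Φ 0 x) →
    ContinuousOn ΨΔ (slabDiamondWithSlab' (B 0) (M 0)) →
    ContMDiffOn 𝓘(ℝ, E4) (𝓡 4) ∞ ΨΔ (slabDiamond' (B 0) (M 0)) →
    IsOpenEmbedding ((slabDiamond' (B 0) (M 0)).restrict ΨΔ) →
    ΨΔ '' slabDiamond' (B 0) (M 0) ⊆ interior (killingDomain 𝒱 M p B Φ) →
    supCkENorm (Subtype.val '' slabDiamond' (B 0) (M 0)) 0 (𝒱.toSpacetime.deviationExtend (B 0) ΨΔ) ≤ 0 →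
    (∀ x ∈ slabDiamond' (B 0) (M 0),
      ξ (ΨΔ x) = mfderiv 𝓘(ℝ, E4) (𝓡 4) ΨΔ x (((mo 0).1 : E4 ≃L[ℝ] E4) (E4.basisVector 0))) →
    ∃ (O₁ : Set 𝒱.carrier) (x₀ : (B 0).domain), IsOpen O₁ ∧ outerRoof 𝒱 M p B Φ ⊆ O₁ ∧
      Φ 0 '' outerSphere (B 0) (M 0) ⊆ O₁ ∧ x₀ ∈ slabDiamond' (B 0) (M 0) ∧ 2 * M 0 < (B 0).radius x₀.1 ∧
      O₁ ∩ interior (killingDomain 𝒱 M p B Φ) ⊆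
        connectedComponentIn
          {z | z ∈ interior (killingDomain 𝒱 M p B Φ) ∧ 𝒱.metric.val z (ξ z) (ξ z) < 0} (ΨΔ x₀)

/-! ### F4b' — coherence: local Kerr charts near the whole outer roof ⟹ one maximal boundary-collar chart -/

/-- **F4b' `RoofCollarCoherence`** — under the hypotheses of the corrected K2a, for its diamond chart
`Ψ_Δ`, and given an open `O₁ ⊇ outerRoof ∪ Φ₀(S₃)` every point of whose trace on `(killingDomain)°`
carries an exact local chart with `ξ = dΨ(Λe₀)` (F3' ∘ F4a'): there is ONE Kerr-side open `O ∋ S₃` and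
ONE chart `Ψ` which is a boundary-collar chart with empty radius clause (`IsBoundaryCollarChart … 0 O Ψ`:
exact on `pullK (Δ½ ∪ (O ∩ J⁺_K(slab)°))`, continuous up to `slab ∪ (O ∩ roofK)`, `= Φ₀` on the slab,
`O ∩ roofK ↦ ∂J⁺(C)`, image in `(killingDomain)°`), with `ξ = dΨ(Λe₀)` on the open part, whose roof
trace `O ∩ roofK` is PAST-CLOSED in `roofK` and is mapped ONTO the whole outer roof of `𝒱`, `Ψ` being a
topological embedding of `pullK ((O ∩ J⁺_K(slab)°) ∪ (O ∩ roofK))`.  Paper proof: developing map of the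
local Kerr structure from the diamond germ along the simply connected one-sided collar (`≅ D² × S²`) of
`Δ½ ∪ roof`, realigning the local charts by `∂_{t*}`-preserving Kerr isometries; the Kerr roof generator
from `s ∈ S₃` develops onto the `𝒱`-generator of `∂J⁺(C)` from `Φ₀(s)` (direction `dΦ₀(L_K)` by the
exact `1`-jet) for as long as the latter exists, a compact generator segment having a uniform tube in
`O₁`; injectivity from the rigidity of the Weyl invariant `(r − ia cos θ)` and of `Ψ_Δ`; `O ∩ roofK =
{gen_s(λ) : λ < λ_max(s)}` is open (lower semicontinuity of `λ_max`) and past-closed.  UNPRINTED (soft: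
no PDE; cf. O'Neill 1983 Prop. 3.62, Hawking–Ellis §6.3); MISSING in the tree. (ref: ONeill1983, Ch. 3, Prop. 3.62)
(ref: HawkingEllis1973CUP, §6.3) Route-posited statement; nothing is asserted. [conjecture] [folklore] -/
def RoofCollarCoherence : Prop :=
  ∀ [Kerr.Facts] (k' : ℕ), 2 ≤ k' →
    ∀ (X : Type) [TopologicalSpace X] [ChartedSpace E3 X] [IsManifold (𝓡 3) ∞ X]
      [T2Space X] [SecondCountableTopology X] [ConnectedSpace X]
      (D : InitialDataSet (𝓡 3) X) (𝒱 : VacuumCauchyDevelopment D)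
      (M a : Fin 1 → ℝ) (p : 𝒱.carrier) (mo : Fin 1 → lorentzGroup × E4)
      (B : Fin 1 → ModelBackground) (Φ : ∀ i, (B i).domain → 𝒱.carrier)
      (hmax : 𝒱.IsMaximal) (hpar : ∀ i, 0 < M i ∧ |a i| < M i),
    (∃ i, p ∈ Φ i '' (B i).truncTimeSlab (3 * M i) 0) →
    (∀ i, B i = starBackground (mo i).1 (mo i).2 (M i) (a i)
      (fun x => Kerr.radius (a i) (poincareInv (mo i).1 (mo i).2 x))) →
    (∀ i, ContMDiffOn 𝓘(ℝ, E4) (𝓡 4) ∞ (Φ i)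
        {x | -1 < (B i).time x.1 ∧ (B i).time x.1 < 1 ∧ (B i).radius x.1 < 3 * M i + 1} ∧
      IsOpenEmbedding ({x | -1 < (B i).time x.1 ∧ (B i).time x.1 < 1 ∧
        (B i).radius x.1 < 3 * M i + 1}.restrict (Φ i))) →
    (∀ i, 𝒱.toSpacetime.truncDeviationCk (B i) (Φ i) k' (3 * M i) 0 ≤ 0) →
    CollarFutureOriented 𝒱 M mo B Φ →
    collarCore M p B Φ ⊆ range 𝒱.embed →
    (∃ m : ℝ, 𝒱.toCauchyDevelopment.HasCutBondiMass (collarCore M p B Φ) m) →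
    ∀ [𝒱.metric.toPseudoRiemannianMetric.HasLeviCivita],
    ∀ (ξ : Π x : 𝒱.carrier, TangentSpace (𝓡 4) x) (ΨΔ : (B 0).domain → 𝒱.carrier),
    𝒱.metric.IsKillingFieldOn ξ (interior (killingDomain 𝒱 M p B Φ)) →
    (∀ x ∈ (B 0).truncTimeSlab (3 * M 0) 0, ΨΔ x = Φ 0 x) →
    ContinuousOn ΨΔ (slabDiamondWithSlab' (B 0) (M 0)) →
    ContMDiffOn 𝓘(ℝ, E4) (𝓡 4) ∞ ΨΔ (slabDiamond' (B 0) (M 0)) →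
    IsOpenEmbedding ((slabDiamond' (B 0) (M 0)).restrict ΨΔ) →
    ΨΔ '' slabDiamond' (B 0) (M 0) ⊆ interior (killingDomain 𝒱 M p B Φ) →
    supCkENorm (Subtype.val '' slabDiamond' (B 0) (M 0)) 0 (𝒱.toSpacetime.deviationExtend (B 0) ΨΔ) ≤ 0 →
    (∀ x ∈ slabDiamond' (B 0) (M 0),
      ξ (ΨΔ x) = mfderiv 𝓘(ℝ, E4) (𝓡 4) ΨΔ x (((mo 0).1 : E4 ≃L[ℝ] E4) (E4.basisVector 0))) →
    (∃ O₁ : Set 𝒱.carrier, IsOpen O₁ ∧ outerRoof 𝒱 M p B Φ ⊆ O₁ ∧ Φ 0 '' outerSphere (B 0) (M 0) ⊆ O₁ ∧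
      ∀ y ∈ O₁ ∩ interior (killingDomain 𝒱 M p B Φ),
        ∃ (Q : Set (B 0).domain) (Ψ : (B 0).domain → 𝒱.carrier), IsOpen Q ∧ y ∈ Ψ '' Q ∧
          ContMDiffOn 𝓘(ℝ, E4) (𝓡 4) ∞ Ψ Q ∧ IsOpenEmbedding (Q.restrict Ψ) ∧
          Ψ '' Q ⊆ interior (killingDomain 𝒱 M p B Φ) ∧
          supCkENorm (Subtype.val '' Q) 0 (𝒱.toSpacetime.deviationExtend (B 0) Ψ) ≤ 0 ∧
          ∀ x ∈ Q, ξ (Ψ x) = mfderiv 𝓘(ℝ, E4) (𝓡 4) Ψ x (((mo 0).1 : E4 ≃L[ℝ] E4) (E4.basisVector 0))) →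
    ∃ (O : Set (Kerr.region (a 0) (M 0))) (Ψ : (B 0).domain → 𝒱.carrier),
      IsBoundaryCollarChart (mo 0) (M 0) (a 0) (hpar 0).1 (B 0) (collarCore M p B Φ)
        (interior (killingDomain 𝒱 M p B Φ)) (Φ 0) 0 O Ψ ∧
      (∀ x ∈ pullK (mo 0) (M 0) (a 0) (B 0) (O ∩ interior (JK (M 0) (a 0) (hpar 0).1 (slabK (M 0) (a 0)))),
        ξ (Ψ x) = mfderiv 𝓘(ℝ, E4) (𝓡 4) Ψ x (((mo 0).1 : E4 ≃L[ℝ] E4) (E4.basisVector 0))) ∧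
      outerSphereK (M 0) (a 0) ⊆ O ∧
      (∀ y ∈ O ∩ roofK (M 0) (a 0) (hpar 0).1,
        JKpast (M 0) (a 0) (hpar 0).1 {y} ∩ roofK (M 0) (a 0) (hpar 0).1 ⊆ O) ∧
      outerRoof 𝒱 M p B Φ ⊆ Ψ '' pullK (mo 0) (M 0) (a 0) (B 0) (O ∩ roofK (M 0) (a 0) (hpar 0).1) ∧
      IsEmbedding ((pullK (mo 0) (M 0) (a 0) (B 0)
        ((O ∩ interior (JK (M 0) (a 0) (hpar 0).1 (slabK (M 0) (a 0)))) ∪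
          (O ∩ roofK (M 0) (a 0) (hpar 0).1))).restrict Ψ)

/-! ### RoofReach — a cut Bondi energy forces the maximal roof chart to cover every radius -/

/-- **`RoofReach`** — under the hypotheses of the corrected K2a (in particular `0 < M` and
`∃ m, HasCutBondiMass C m`), a maximal boundary-collar chart as delivered by `RoofCollarCoherence`
(past-closed roof trace `O ∩ roofK ∋ S₃` mapped ONTO the outer roof of `𝒱`, an embedding up to the roof)
covers the Kerr roof portion `roofK ∩ {r ≤ ρ}` for EVERY `ρ`.  Paper proof (worker K2a, confirming the
lead's estimate): if the generator in the direction `ω₀` were covered only up to Kerr radius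
`r_cut(ω₀) < ∞`, its `𝒱`-image is a future-INCOMPLETE generator of `∂J⁺(C)` (a future endpoint in `𝒱`
would lie on the outer roof, hence in the image, contradicting maximality through the embedding clause).
The round receding sections `S_s` of `HasCutBondiMass` lie on the outer roof for large `s` (not inside the
spacelike `C` by the generator clause `tangent_L`, not on the inner sheet from the inner edge `{r = M}`,
whose generators leave a TRAPPED sphere and focus in vacuum within bounded area — Raychaudhuri), are
spacelike hence transverse to the generators, hence (compact, `S²` simply connected: covering argument)
GLOBAL graphs `r = f_s(ω)` over the generator sphere with `f_s(ω₀) < r_cut(ω₀)` PINNED while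
`|S_s| → ∞`.  Roundness gives `K_s > 0` eventually, i.e. `Δ_{γ̊} log f_s ≤ 1` (Gauss equation on the
cone), whence the circle means of `log f_s` about `ω₀` stay `≤ log r_cut(ω₀) + c` and `⨍ 1/f_s ≥ c'/r_cut(ω₀)`;
on a Schwarzschild cone `m_H(S_s) = M √(⨍ f_s²) ⨍ (1/f_s)` exactly (Gauss equation
`K = −¼ θθ̲ + 2M/f³`, `dA = f² dω̊`), so `m_H(S_s) ≥ c' M √(|S_s|/4π)/r_cut → ∞` — no finite mass limit
(Kerr: the same with `o(1)` corrections).  For `M = 0` the statement would fail (Minkowski cone sections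
all have `m_H = 0`), consistent with `0 < M`.  UNPRINTED (the lopsided-section Hawking-mass divergence;
cf. Christodoulou–Klainerman 1993 Ch. 17 for the vocabulary); MISSING in the tree.
(ref: ChristodoulouKlainerman1993PMS41, Ch. 17, (17.0.2)) (ref: HawkingEllis1973CUP, §4.2 (Raychaudhuri))
Route-posited statement; nothing is asserted. [conjecture] [folklore] -/
def RoofReach : Prop :=
  ∀ [Kerr.Facts] (k' : ℕ), 2 ≤ k' →
    ∀ (X : Type) [TopologicalSpace X] [ChartedSpace E3 X] [IsManifold (𝓡 3) ∞ X]
      [T2Space X] [SecondCountableTopology X] [ConnectedSpace X]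
      (D : InitialDataSet (𝓡 3) X) (𝒱 : VacuumCauchyDevelopment D)
      (M a : Fin 1 → ℝ) (p : 𝒱.carrier) (mo : Fin 1 → lorentzGroup × E4)
      (B : Fin 1 → ModelBackground) (Φ : ∀ i, (B i).domain → 𝒱.carrier)
      (hmax : 𝒱.IsMaximal) (hpar : ∀ i, 0 < M i ∧ |a i| < M i),
    (∃ i, p ∈ Φ i '' (B i).truncTimeSlab (3 * M i) 0) →
    (∀ i, B i = starBackground (mo i).1 (mo i).2 (M i) (a i)
      (fun x => Kerr.radius (a i) (poincareInv (mo i).1 (mo i).2 x))) →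
    (∀ i, ContMDiffOn 𝓘(ℝ, E4) (𝓡 4) ∞ (Φ i)
        {x | -1 < (B i).time x.1 ∧ (B i).time x.1 < 1 ∧ (B i).radius x.1 < 3 * M i + 1} ∧
      IsOpenEmbedding ({x | -1 < (B i).time x.1 ∧ (B i).time x.1 < 1 ∧
        (B i).radius x.1 < 3 * M i + 1}.restrict (Φ i))) →
    (∀ i, 𝒱.toSpacetime.truncDeviationCk (B i) (Φ i) k' (3 * M i) 0 ≤ 0) →
    CollarFutureOriented 𝒱 M mo B Φ →
    collarCore M p B Φ ⊆ range 𝒱.embed →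
    (∃ m : ℝ, 𝒱.toCauchyDevelopment.HasCutBondiMass (collarCore M p B Φ) m) →
    ∀ [𝒱.metric.toPseudoRiemannianMetric.HasLeviCivita],
    ∀ (ξ : Π x : 𝒱.carrier, TangentSpace (𝓡 4) x)
      (O : Set (Kerr.region (a 0) (M 0))) (Ψ : (B 0).domain → 𝒱.carrier),
    𝒱.metric.IsKillingFieldOn ξ (interior (killingDomain 𝒱 M p B Φ)) →
    IsBoundaryCollarChart (mo 0) (M 0) (a 0) (hpar 0).1 (B 0) (collarCore M p B Φ)
      (interior (killingDomain 𝒱 M p B Φ)) (Φ 0) 0 O Ψ →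
    (∀ x ∈ pullK (mo 0) (M 0) (a 0) (B 0) (O ∩ interior (JK (M 0) (a 0) (hpar 0).1 (slabK (M 0) (a 0)))),
      ξ (Ψ x) = mfderiv 𝓘(ℝ, E4) (𝓡 4) Ψ x (((mo 0).1 : E4 ≃L[ℝ] E4) (E4.basisVector 0))) →
    outerSphereK (M 0) (a 0) ⊆ O →
    (∀ y ∈ O ∩ roofK (M 0) (a 0) (hpar 0).1,
      JKpast (M 0) (a 0) (hpar 0).1 {y} ∩ roofK (M 0) (a 0) (hpar 0).1 ⊆ O) →
    outerRoof 𝒱 M p B Φ ⊆ Ψ '' pullK (mo 0) (M 0) (a 0) (B 0) (O ∩ roofK (M 0) (a 0) (hpar 0).1) →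
    IsEmbedding ((pullK (mo 0) (M 0) (a 0) (B 0)
      ((O ∩ interior (JK (M 0) (a 0) (hpar 0).1 (slabK (M 0) (a 0)))) ∪
        (O ∩ roofK (M 0) (a 0) (hpar 0).1))).restrict Ψ) →
    ∀ ρ : ℝ, roofK (M 0) (a 0) (hpar 0).1 ∩ {y | Kerr.radius (a 0) y.1 ≤ ρ} ⊆ O

/-! ### Bookkeeping: a boundary-collar chart with empty radius clause and a covered roof portion -/

omit [IsManifold (𝓡 3) ∞ X] [ConnectedSpace X] in
/-- Monotonicity of `IsBoundaryCollarChart` in the radius clause: if the roof portion up to `ρ` is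
covered by `O`, a boundary-collar chart for any radius is one for `ρ` (clause 2 is the only clause
mentioning the radius). [folklore] -/
theorem IsBoundaryCollarChart.of_roof_subset [Kerr.Facts] {𝒮 : Spacetime.{0} 4} {mo : lorentzGroup × E4}
    {M a : ℝ} {hM : 0 < M} {B : ModelBackground} {C J : Set 𝒮.carrier} {Φ₀ : B.domain → 𝒮.carrier}
    {ρ₀ ρ : ℝ} {O : Set (Kerr.region a M)} {Ψ : B.domain → 𝒮.carrier}
    (h : IsBoundaryCollarChart mo M a hM B C J Φ₀ ρ₀ O Ψ)
    (hρ : roofK M a hM ∩ {y | Kerr.radius a y.1 ≤ ρ} ⊆ O) :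
    IsBoundaryCollarChart mo M a hM B C J Φ₀ ρ O Ψ :=
  ⟨h.1, hρ, h.2.2⟩

/-! ### The checked reduction of the corrected K2a -/

/-- **The corrected K2a from the four typed inputs** (pure plumbing): the diamond chart of the
hypothesis seeds F4a' (an open `O₁ ⊇ outerRoof ∪ Φ₀(S₃)` inside the timelike component of a shell point
`Ψ_Δ x₀`) and F3' (local exact `ξ`-charts on that component, seed `Q₀ = Δ'`); F4b' assembles the maximal
boundary-collar chart; `RoofReach` supplies the radius clause for every `ρ`. [folklore] -/
theorem outerBoundaryCollarChartOriented'_of_facts (h3 : TimelikeKillingKerrContinuation')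
    (h4a : OuterRoofStationarity') (h4b : RoofCollarCoherence) (hreach : RoofReach) :
    OuterBoundaryCollarChartOriented' := by
  intro _ k' hk' X _ _ _ _ _ _ D 𝒱 M a p mo B Φ hmax hpar hp hB hΦ hdev hor hCX hcut _ ξ hξ hdia ρ
  obtain ⟨ΨΔ, hΨΦ, hc, hs, he, hJ, hd, hξΔ⟩ := hdia
  -- F4a': the roof neighbourhood inside the timelike component of a shell point of the diamond
  obtain ⟨O₁, x₀, hO₁, hroofO₁, hS₃O₁, hx₀, hx₀r, hcomp⟩ :=
    h4a k' hk' X D 𝒱 M a p mo B Φ hmax hpar hp hB hΦ hdev hor hCX hcut ξ ΨΔ hξ hΨΦ hc hs he hJ hd hξΔ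
  -- F3': local exact `ξ`-charts at every point of that component (seed: the corrected diamond)
  have hopenΔ : IsOpen (slabDiamond' (B 0) (M 0)) := by
    rw [slabDiamond'_eq_pullK' (hB 0)]
    have : pullK' (mo 0) (M 0) (a 0) (B 0) (diamondK (M 0) (a 0)) =
        pullK (mo 0) (M 0) (a 0) (B 0) (diamondK (M 0) (a 0)) := rfl
    rw [this]
    exact isOpen_pullK_of_eq (hB 0) (isOpen_diamondK (M 0) (a 0))
  have hloc : ∀ y ∈ O₁ ∩ interior (killingDomain 𝒱 M p B Φ),
      ∃ (Q : Set (B 0).domain) (Ψ : (B 0).domain → 𝒱.carrier), IsOpen Q ∧ y ∈ Ψ '' Q ∧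
        ContMDiffOn 𝓘(ℝ, E4) (𝓡 4) ∞ Ψ Q ∧ IsOpenEmbedding (Q.restrict Ψ) ∧
        Ψ '' Q ⊆ interior (killingDomain 𝒱 M p B Φ) ∧
        supCkENorm (Subtype.val '' Q) 0 (𝒱.toSpacetime.deviationExtend (B 0) Ψ) ≤ 0 ∧
        ∀ x ∈ Q, ξ (Ψ x) = mfderiv 𝓘(ℝ, E4) (𝓡 4) Ψ x (((mo 0).1 : E4 ≃L[ℝ] E4) (E4.basisVector 0)) :=
    fun y hy ↦ h3 X D 𝒱 (M 0) (a 0) (mo 0) (B 0) (interior (killingDomain 𝒱 M p B Φ)) ξ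
      (slabDiamond' (B 0) (M 0)) ΨΔ x₀ (hpar 0).1 (hpar 0).2 (hB 0) isOpen_interior hξ hopenΔ hx₀ hx₀r
      hs he hJ hd hξΔ y (hcomp hy)
  -- F4b': the maximal boundary-collar chart
  obtain ⟨O, Ψ, hbcc, hξO, hS₃, hpast, honto, hemb⟩ :=
    h4b k' hk' X D 𝒱 M a p mo B Φ hmax hpar hp hB hΦ hdev hor hCX hcut ξ ΨΔ hξ hΨΦ hc hs he hJ hd hξΔ
      ⟨O₁, hO₁, hroofO₁, hS₃O₁, hloc⟩
  -- RoofReach: the radius clause for `ρ`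
  have hρ := hreach k' hk' X D 𝒱 M a p mo B Φ hmax hpar hp hB hΦ hdev hor hCX hcut ξ O Ψ hξ hbcc hξO hS₃
    hpast honto hemb ρ
  exact ⟨O, Ψ, hbcc.of_roof_subset hρ, hξO⟩

end K2Route

/-- **Closed form for a registered (corrected) stub** `stub_outerBoundaryCollarChart'`: the corrected
K2a follows from F3', F4a', F4b' and `RoofReach`. [conjecture] [folklore] -/
theorem stub_outerBoundaryCollarChart'_of_facts : K2Route.TimelikeKillingKerrContinuation' → K2Route.OuterRoofStationarity' → K2Route.RoofCollarCoherence → K2Route.RoofReach → K2Route.OuterBoundaryCollarChartOriented' :=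
  fun h3 h4a h4b hr ↦ K2Route.outerBoundaryCollarChartOriented'_of_facts h3 h4a h4b hr

end Summit.FinalStateConjecture.FinalStateConjecture.Theorems.BondiBartnikRigidity.DirectMethod

end
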